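import Literature.NumberTheory.EllipticCurves.CuspFormTwistGamma1
import Literature.NumberTheory.EllipticCurves.CuspFormTwistModularSymbol
import Literature.NumberTheory.EllipticCurves.EichlerShimuraPeriodsGamma1
import HarnessLib

/-!
# Level lowering kills Kurihara numbers mod `p`, part 4c: modular symbols of weight-2 cusp forms on `Γ₁(N)` and Shimura's Prop. 3.64 AT THE LEVEL OF MODULAR SYMBOLS for a source WITH NEBENTYPUS and a character of ANY ORDER (cell `b2b-bsdres`, seat additive-p4, line V80)

HONEST FRAMING (verbatim, cell `b2b-bsdres`): the goal of the cell is to DELETE the COMBINATION-SHAPED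
residual classes for ALL analytic-rank `≤ 1` curves over `ℚ` — "full BSD formula for every rank `≤ 1`
curve in class `C`" assembled STRICTLY from published theorems — so that the rank-`≤ 1` remainder
becomes exactly the CONSTRUCTION-SHAPED classes, which are TYPED (missing-input Props), NOT attempted;
this is not "finishing BSD". This file: research-route KERNEL THEOREMS (complex analysis over the
tree's `twistRaw1` / `IsCuspFunction`; no named fact, no conjecture, nothing booked; class X4 stays
CONSTRUCTION-SHAPED).

## What is proved

Part 4b (`X4/CharacterTwistTransport`) transports the level-lowering certificate along the twist
`f_W = g ⊗ χ̄` by a character `χ` of ANY order; its analytic hypothesis `hsym` is Shimura 1971,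
Prop. 3.64 read at the level of modular symbols, `{∞, r}_{g ⊗ χ̄} = g(χ)⁻¹ ∑_{u mod m} χ(u) {∞, r + u/m}_g`
at EVERY cusp `r`, for a source newform `g` WITH NEBENTYPUS `ψ`. The tree proves this identity only
for `g` on `Γ₀(N)` and `χ` quadratic (`ModularForms.modularSymbol_charTwist`), and has no modular
symbols for forms on `Γ₁(N)`; it DOES have the twist itself in full generality
(`ModularForms.twistRaw1` of `CuspFormTwistGamma1`: `f ∈ S_k(N, ψ) ⊆ S_k(Γ₁(N))`, any `χ mod m`,
`N ∣ L`, `m² ∣ L`, `N m ∣ L`, `∑_u χ⁻¹(u) f(τ + u/m) ∈ S_k(Γ₁(L))`, multiplier `ψ(d)χ(d)²` under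
`Γ₀(L)`). This file supplies the modular-symbol layer on `Γ₁`:

* §1 `modularSymbol1 g r := 2π ∫₀^∞ g(r + it) dt` for `g ∈ S₂(Γ₁(N))` (the SAME formula as the tree's
  `Γ₀`-typed `modularSymbol`), `plusSymbol1` / `minusSymbol1`; **`integrableOn_modularSymbol1_integrand`**
  (absolute convergence at every rational cusp: the `Γ₀` proof of `ModularSymbolsProofs` verbatim, run
  on the tree's `isCuspFunction_one_gamma1` / `isCuspFunction_slash_gamma1` — near `t = 0⁺` the
  substitution `t = 1/(c²u)` along `δ_r`, `δ_r ∞ = r`); `modularSymbol1_add_intCast`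
  (`{∞, r + n} = {∞, r}`) and the `u ↦ -u` re-indexing `sum_mul_modularSymbol1_neg_add_of_even` for an
  EVEN character of any order (every character of odd order is even).
* §2 **`modularSymbol1_twistRaw1`** — Shimura 3.64 integrated along the ray, source with nebentypus,
  character of any order: `{∞, r}_{twistRaw1 f χ} = ∑_{u mod m} χ⁻¹(u) {∞, r + u/m}_f` for all `r ∈ ℚ`
  (`twistRaw1_apply_ofComplex`: the identity pointwise on the ray; the finitely many integrals converge
  absolutely by §1, so the sum comes out).

The `Γ₀(L)`-descent for a TRIVIAL target character (`ψχ² = 1`: the case `f_W = g ⊗ χ̄` of an elliptic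
curve) and the tree's `Γ₀` `modularSymbol` / `plusSymbol` of it are in the sequel
`X4/NebentypusTwistModularSymbol`. Not given anywhere (typed, not attempted): algebraicity of the `Γ₁`
symbols in the coefficient field, the period comparison, the reduction mod `𝔭 ∣ p` — part 4b's `hsym`
is a statement in `ℤ/p`.

## References

* G. Shimura, *Introduction to the arithmetic theory of automorphic functions* (1971), Prop. 3.64.
  [cite: Shimura1971, Prop. 3.64]
* B. Mazur, J. Tate, J. Teitelbaum, Invent. Math. 84 (1986), §I.8 (twisted modular symbols).
  [cite: MazurTateTeitelbaum1986Invent, §I.8]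
* Ju. I. Manin, *Parabolic points and zeta functions of modular curves*, Izv. 6 (1972), §1.2–§1.5.
  [cite: Manin1972, §1.2–1.5]
-/

noncomputable section

open scoped MatrixGroups ModularForm Real

open CongruenceSubgroup Matrix.SpecialLinearGroup Matrix.GeneralLinearGroup UpperHalfPlane Complex
  MeasureTheory Set

open Literature.NumberTheory.EllipticCurves Literature.NumberTheory.EllipticCurves.ModularForms

namespace Summit.BirchSwinnertonDyer.Rank1Residual.NebentypusTwist

/-! ### §1 Modular symbols of weight-`2` cusp forms on `Γ₁(N)` -/

section Gamma1Symbols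

variable {N : ℕ}

/-- The **modular symbol** `{∞, r}_g = 2πi ∫_{i∞}^{r} g(z) dz = 2π ∫₀^∞ g(r + it) dt` of a weight-`2`
cusp form `g` on `Γ₁(N)` at a rational cusp `r` — the same formula as the tree's `Γ₀`-typed
`ModularForms.modularSymbol` (Manin 1972, §1.2–1.5). [cite: Manin1972, §1.2–1.5] -/
def modularSymbol1 (g : CuspForm (Gamma1 N) 2) (r : ℚ) : ℂ :=
  2 * Real.pi * ∫ t in Ioi (0 : ℝ), g (ofComplex ((r : ℂ) + t * Complex.I))

/-- The **plus symbol** `({∞, r}_g + {∞, -r}_g) / 2` of `g ∈ S₂(Γ₁(N))` (convention of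
Mazur–Tate–Teitelbaum §I.8, as the tree's `plusSymbol`). [cite: MazurTateTeitelbaum1986Invent, §I.8] -/
def plusSymbol1 (g : CuspForm (Gamma1 N) 2) (r : ℚ) : ℂ :=
  (modularSymbol1 g r + modularSymbol1 g (-r)) / 2

/-- The **minus symbol** `({∞, r}_g - {∞, -r}_g) / 2` of `g ∈ S₂(Γ₁(N))`.
[cite: MazurTateTeitelbaum1986Invent, §I.8] -/
def minusSymbol1 (g : CuspForm (Gamma1 N) 2) (r : ℚ) : ℂ :=
  (modularSymbol1 g r - modularSymbol1 g (-r)) / 2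

/-- **Weight-`2` transformation along the ray, for a bare function** `φ : ℍ → ℂ`: with
`t = 1/(c²u)`, `φ(a/c + it) · |dt/du| = -(φ ∣[2] γ)(-d/c + iu)` (`γ = (a b; c d)`, `c ≠ 0`; the tree's
`jacobian_smul_ray` is this statement for a `Γ₀(N)`-form). [folklore] -/
theorem jacobian_smul_ray_fun (φ : ℍ → ℂ) (g : SL(2, ℤ)) (hc : (g 1 0 : ℤ) ≠ 0) {u : ℝ} (hu : 0 < u) :
    |(-(1 / (((g 1 0 : ℤ) : ℝ) ^ 2 * u ^ 2)) : ℝ)| •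
      φ (ofComplex (((g 0 0 : ℤ) : ℂ) / ((g 1 0 : ℤ) : ℂ) +
        ((1 / (((g 1 0 : ℤ) : ℝ) ^ 2 * u) : ℝ) : ℂ) * Complex.I)) =
      -(φ ∣[(2 : ℤ)] g) (ofComplex (-((g 1 1 : ℤ) : ℂ) / ((g 1 0 : ℤ) : ℂ) + u * Complex.I)) := by
  have hc' : ((g 1 0 : ℤ) : ℂ) ≠ 0 := by exact_mod_cast hc
  have hcR : ((g 1 0 : ℤ) : ℝ) ≠ 0 := by exact_mod_cast hc
  have hu' : (u : ℂ) ≠ 0 := by exact_mod_cast hu.ne'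
  have him : 0 < (-((g 1 1 : ℤ) : ℂ) / ((g 1 0 : ℤ) : ℂ) + u * Complex.I).im := by
    simpa [div_im] using hu
  rw [ModularForm.SL_slash_apply, smul_ofComplex g him, moebius_ray g hc hu.ne',
    denom_ofComplex g him, denom_ray g hc u, abs_of_neg (by
      have : 0 < 1 / (((g 1 0 : ℤ) : ℝ) ^ 2 * u ^ 2) := by positivity
      linarith), Complex.real_smul]
  push_cast
  rw [zpow_neg, zpow_two]
  field_simp
  rw [I_sq]
  ring

variable [NeZero N] (f : CuspForm (Gamma1 N) 2) (g : SL(2, ℤ))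

/-- **Integrability of the modular-symbol integrand of a `Γ₁(N)`-form at a cusp `γ∞`** (`γ ∈ SL(2, ℤ)`,
`c ≠ 0`): `t ↦ g(a/c + it)` is integrable on `(0, ∞)` — the tail by exponential decay of `g` along the
ray above `γw₀`, the head `(0, 1/|c|)` by the substitution `t = 1/(c²u)`, which turns it into
`-(g ∣[2] γ)(-d/c + iu)`, integrable by cuspidality of `g ∣[2] γ` at `∞` (the tree's
`isCuspFunction_slash_gamma1`) (Manin 1972, §1.5). [cite: Manin1972, §1.2–1.5] -/
theorem integrableOn_modularSymbol1_integrand_smul (hc : (g 1 0 : ℤ) ≠ 0) :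
    IntegrableOn (fun t : ℝ ↦ f (ofComplex (((g 0 0 : ℤ) : ℂ) / ((g 1 0 : ℤ) : ℂ) + t * Complex.I)))
      (Ioi 0) := by
  have hCR : ((g 1 0 : ℤ) : ℝ) ≠ 0 := by exact_mod_cast hc
  have hCa : (0 : ℝ) < |((g 1 0 : ℤ) : ℝ)| := abs_pos.mpr hCR
  have hT : (0 : ℝ) < 1 / |((g 1 0 : ℤ) : ℝ)| := by positivity
  -- the tail `(1/|c|, ∞)`: a translate of the ray above `γ w₀`
  have htail : IntegrableOn
      (fun t : ℝ ↦ f (ofComplex (((g 0 0 : ℤ) : ℂ) / ((g 1 0 : ℤ) : ℂ) + t * Complex.I)))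
      (Ioi (1 / |((g 1 0 : ℤ) : ℝ)|)) := by
    rw [integrableOn_Ioi_iff_integrableOn_Ioi_add]
    have := (isCuspFunction_one_gamma1 f).integrableOn_ray (g • ofComplex (rayBase g))
    rw [coe_smul_rayBase g hc] at this
    refine this.congr_fun (fun t _ ↦ ?_) measurableSet_Ioi
    dsimp only
    congr 2
    push_cast
    ring
  -- the head `(0, 1/|c|)`: image of the ray above `w₀` under `u ↦ 1/(c²u)`
  have hhead : IntegrableOn
      (fun t : ℝ ↦ f (ofComplex (((g 0 0 : ℤ) : ℂ) / ((g 1 0 : ℤ) : ℂ) + t * Complex.I)))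
      (Ioo 0 (1 / |((g 1 0 : ℤ) : ℝ)|)) := by
    rw [← image_inv_ray hCR, integrableOn_image_iff_integrableOn_abs_deriv_smul
      measurableSet_Ioi (fun u hu ↦ (hasDerivAt_inv_ray hCR
        (lt_trans hT hu).ne').hasDerivWithinAt) (injOn_inv_ray hCR _)]
    have H : IntegrableOn (fun u : ℝ ↦ (⇑f ∣[(2 : ℤ)] g)
        (ofComplex (-((g 1 1 : ℤ) : ℂ) / ((g 1 0 : ℤ) : ℂ) + u * Complex.I)))
        (Ioi (1 / |((g 1 0 : ℤ) : ℝ)|)) := by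
      rw [integrableOn_Ioi_iff_integrableOn_Ioi_add]
      have := (isCuspFunction_slash_gamma1 f g).integrableOn_ray (ofComplex (rayBase g))
      rw [coe_ofComplex_rayBase g hc] at this
      refine this.congr_fun (fun t _ ↦ ?_) measurableSet_Ioi
      dsimp only
      rw [rayBase]
      push_cast
      ring_nf
    refine H.neg.congr_fun (fun u hu ↦ ?_) measurableSet_Ioi
    simp only [Pi.neg_apply]
    exact (jacobian_smul_ray_fun (⇑f) g hc (lt_trans hT hu)).symm
  rw [← Ioc_union_Ioi_eq_Ioi hT.le]
  exact ((integrableOn_Ioc_iff_integrableOn_Ioo).mpr hhead).union htail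

/-- **The modular-symbol integrand of a `Γ₁(N)`-form is integrable at every rational cusp**
(`r = δ_r ∞` with the tree's `cuspMatrix r ∈ SL(2, ℤ)`). [cite: Manin1972, §1.2–1.5] -/
theorem integrableOn_modularSymbol1_integrand (r : ℚ) :
    IntegrableOn (fun t : ℝ ↦ f (ofComplex ((r : ℂ) + t * Complex.I))) (Ioi 0) := by
  have := integrableOn_modularSymbol1_integrand_smul f (cuspMatrix r)
    (cuspMatrix_apply_one_zero_ne_zero r)
  refine this.congr_fun (fun t _ ↦ ?_) measurableSet_Ioi
  simp [Rat.cast_def]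

/-- **`{∞, r + n}_g = {∞, r}_g`** for `n ∈ ℤ`, from `g(z + 1) = g(z)` (`T ∈ Γ₁(N)`; the tree's
`isCuspFunction_one_gamma1`) (Manin 1972, §1.2). [cite: Manin1972, §1.2–1.5] -/
theorem modularSymbol1_add_intCast (r : ℚ) (n : ℤ) :
    modularSymbol1 f (r + n) = modularSymbol1 f r := by
  simp only [modularSymbol1]
  congr 1
  refine setIntegral_congr_fun measurableSet_Ioi fun t _ ↦ ?_
  have := (isCuspFunction_one_gamma1 f).periodic.int_mul n ((r : ℂ) + t * Complex.I)
  simp only [Function.comp_apply] at this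
  push_cast
  convert this using 3
  push_cast
  ring

end Gamma1Symbols

/-! ### §1b Reflection `r ↦ -r` and the `u ↦ -u` re-indexing for an even character of any order -/

section Reflection

variable {N : ℕ} [NeZero N] {m : ℕ} [NeZero m]

/-- `u/m` and `(-u)/m` (representatives in `[0, 1)`) differ from each other's negatives by an
integer: `twistShift (-u) = -twistShift u + z` with `z ∈ {0, 1}`. [folklore] -/
private theorem exists_twistShift_neg_eq (u : ZMod m) :
    ∃ z : ℤ, twistShift (-u) = -twistShift u + z := by
  by_cases hu : u = 0
  · refine ⟨0, ?_⟩
    subst hu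
    simp [twistShift]
  · refine ⟨1, ?_⟩
    have hm0 : (m : ℚ) ≠ 0 := by exact_mod_cast (NeZero.ne m)
    rw [twistShift, twistShift, ZMod.neg_val, if_neg hu, Nat.cast_sub (ZMod.val_lt u).le]
    field_simp
    ring

/-- `{∞, -r + (-u)/m}_g = {∞, -(r + u/m)}_g` for a `Γ₁`-form `g` (the two cusps differ by an
integer, `modularSymbol1_add_intCast`). [cite: Manin1972, §1.2–1.5] -/
theorem modularSymbol1_neg_add_twistShift_neg (f : CuspForm (Gamma1 N) 2) (r : ℚ) (u : ZMod m) :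
    modularSymbol1 f (-r + twistShift (-u)) = modularSymbol1 f (-(r + twistShift u)) := by
  obtain ⟨z, hz⟩ := exists_twistShift_neg_eq (m := m) u
  rw [hz, show -r + (-twistShift u + (z : ℚ)) = -(r + twistShift u) + z by ring]
  exact modularSymbol1_add_intCast f _ z

/-- The `u ↦ -u` re-indexing behind the plus/minus symbols of a twist, `Γ₁` source, EVEN character
`χ'` (any order): `∑_u χ'(u) {∞, -r + u/m}_g = ∑_u χ'(u) {∞, -(r + u/m)}_g`.
[cite: MazurTateTeitelbaum1986Invent, §I.8] -/
theorem sum_mul_modularSymbol1_neg_add_of_even (f : CuspForm (Gamma1 N) 2)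
    {χ' : DirichletCharacter ℂ m} (hχe : χ'.Even) (r : ℚ) :
    ∑ u : ZMod m, χ' u * modularSymbol1 f (-r + twistShift u) =
      ∑ u : ZMod m, χ' u * modularSymbol1 f (-(r + twistShift u)) := by
  rw [← Equiv.sum_comp (Equiv.neg (ZMod m))]
  refine Finset.sum_congr rfl fun u _ ↦ ?_
  rw [Equiv.neg_apply, modularSymbol1_neg_add_twistShift_neg, neg_eq_neg_one_mul u, map_mul,
    hχe, one_mul]

omit [NeZero m] in
/-- The inverse of an even character is even (`χ⁻¹(-1) = (χ(-1))⁻¹ = 1`); every character of ODD order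
is even. [folklore] -/
theorem even_inv_of_even {χ : DirichletCharacter ℂ m} (hχe : χ.Even) : χ⁻¹.Even := by
  change χ⁻¹ (-1) = 1
  rw [MulChar.inv_apply_eq_inv', hχe, inv_one]


end Reflection

/-! ### §2 Shimura 3.64 along the ray and at the level of modular symbols: source with nebentypus, any `χ` -/

section TwistSymbol

variable {N : ℕ} [NeZero N] {m : ℕ} [NeZero m] (L : ℕ) [NeZero L]

omit [NeZero N] [NeZero m] [NeZero L] in
/-- Translating the vertical ray above `r` by the rational `q`: `q +ᵥ (r + it) = (r + q) + it` in `ℍ`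
(`t > 0`). [folklore] -/
private theorem ratCast_vadd_ofComplex_add_mul_I (q r : ℚ) {t : ℝ} (ht : 0 < t) :
    (((q : ℝ)) +ᵥ ofComplex ((r : ℂ) + t * Complex.I) : ℍ) =
      ofComplex (((r + q : ℚ) : ℂ) + t * Complex.I) := by
  have h1 : 0 < ((r : ℂ) + t * Complex.I).im := by simpa using ht
  have h2 : 0 < (((r + q : ℚ) : ℂ) + t * Complex.I).im := by simpa using ht
  rw [ofComplex_apply_of_im_pos h1, ofComplex_apply_of_im_pos h2]
  ext1
  simp only [coe_vadd, Complex.ofReal_ratCast]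
  push_cast
  ring

/-- **The raw twist of a form with nebentypus along the vertical ray above a cusp**: for `t > 0`,
`(twistRaw1 f χ)(r + it) = ∑_{u mod m} χ⁻¹(u) f((r + u/m) + it)` (Shimura 1971, Prop. 3.64, the
function `∑_u χ̄(u) f(z + u/r)`, evaluated). [cite: Shimura1971, Prop. 3.64] -/
theorem twistRaw1_apply_ofComplex (hN : N ∣ L) (hm : m ^ 2 ∣ L) (hNm : N * m ∣ L)
    {ψ : DirichletCharacter ℂ N} {f : CuspForm (Gamma1 N) 2} (hf : f ∈ nebentypusSubspace N 2 ψ)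
    (χ : DirichletCharacter ℂ m) (r : ℚ) {t : ℝ} (ht : 0 < t) :
    twistRaw1 L hN hm hNm hf χ (ofComplex ((r : ℂ) + t * Complex.I)) =
      ∑ u : ZMod m, χ⁻¹ u * f (ofComplex (((r + twistShift u : ℚ) : ℂ) + t * Complex.I)) := by
  have hcoe := congrFun (coe_twistRaw1 L hN hm hNm hf χ) (ofComplex ((r : ℂ) + t * Complex.I))
  rw [hcoe, Finset.sum_apply]
  refine Finset.sum_congr rfl fun u _ ↦ ?_
  rw [Pi.smul_apply, smul_eq_mul, slash_twistT_apply, ratCast_vadd_ofComplex_add_mul_I _ _ ht]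

/-- **Modular symbols of the twist of a form WITH NEBENTYPUS by a character of ANY ORDER**
(Shimura 1971, Prop. 3.64 integrated along the ray; Mazur–Tate–Teitelbaum 1986 §I.8): for
`f ∈ S₂(N, ψ)`, `χ mod m`, `N ∣ L`, `m² ∣ L`, `N m ∣ L` and every `r ∈ ℚ`,
`{∞, r}_{twistRaw1 f χ} = ∑_{u mod m} χ⁻¹(u) {∞, r + u/m}_f` (both sides `Γ₁` modular symbols, §1).
The integrals converge absolutely (`integrableOn_modularSymbol1_integrand`), so the finite sum may be
taken outside. [cite: Shimura1971, Prop. 3.64] [cite: MazurTateTeitelbaum1986Invent, §I.8] -/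
theorem modularSymbol1_twistRaw1 (hN : N ∣ L) (hm : m ^ 2 ∣ L) (hNm : N * m ∣ L)
    {ψ : DirichletCharacter ℂ N} {f : CuspForm (Gamma1 N) 2} (hf : f ∈ nebentypusSubspace N 2 ψ)
    (χ : DirichletCharacter ℂ m) (r : ℚ) :
    modularSymbol1 (twistRaw1 L hN hm hNm hf χ) r =
      ∑ u : ZMod m, χ⁻¹ u * modularSymbol1 f (r + twistShift u) := by
  have hint : ∀ u : ZMod m, IntegrableOn
      (fun t : ℝ ↦ χ⁻¹ u * f (ofComplex (((r + twistShift u : ℚ) : ℂ) + t * Complex.I)))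
      (Ioi 0) := fun u ↦
    (integrableOn_modularSymbol1_integrand f (r + twistShift u)).const_mul (χ⁻¹ u)
  have key : ∫ t in Ioi (0 : ℝ), twistRaw1 L hN hm hNm hf χ (ofComplex ((r : ℂ) + t * Complex.I)) =
      ∑ u : ZMod m, χ⁻¹ u * ∫ t in Ioi (0 : ℝ),
          f (ofComplex (((r + twistShift u : ℚ) : ℂ) + t * Complex.I)) := by
    rw [setIntegral_congr_fun measurableSet_Ioi
      (fun t ht ↦ twistRaw1_apply_ofComplex L hN hm hNm hf χ r ht),
      integral_finsetSum _ (fun u _ ↦ hint u)]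
    refine Finset.sum_congr rfl fun u _ ↦ ?_
    exact integral_const_mul _ _
  simp only [modularSymbol1]
  rw [key, Finset.mul_sum]
  exact Finset.sum_congr rfl fun u _ ↦ by ring

end TwistSymbol

end Summit.BirchSwinnertonDyer.Rank1Residual.NebentypusTwist

end
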